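import Summits.QuantumFields.YangMills.Theorems.UnitScaleTiltHalvingHSiteTopOfDatumGamma
import Summits.QuantumFields.YangMills.Theorems.UnitScaleTiltHalvingHSiteDatumOfSocketsTGamma
import Summits.QuantumFields.YangMills.Theorems.UnitScaleTiltHalvingHSiteDatumRowsGamma
import Summits.QuantumFields.YangMills.Theorems.UnitScaleTiltHalvingHSiteTopKnit
import Summits.QuantumFields.YangMills.Theorems.UnitScaleTiltHalvingHSiteTopH42OfRowsGamma
import Summits.QuantumFields.YangMills.Theorems.UnitScaleTiltHalvingHSiteSizeRowsOfTopRowsGamma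
import HarnessLib

/-!
# `hP1room` PROGRAMME — EDITION γ (OWNER RULING g28-№11; LEAD-H WORDS 21∕22∕25), FILE (γ-3): ★★★ THE PER-SITE COMPOSER FOR `2 ≤ K − n`, EDITION γ

Route `UnitScaleTilt`, crux K1 child «MinimiserStabilityRegPr» (stmt-QuantumFields-19200), registered stub `stub_halvingStep` (`BirthV10`), display of record v5.1 (✓p675610)
under FLAG №10 (cure of record = edition γ: PRINT's split class `cubeLamBP′`, box law «box ⊂ Ω_{j−1}», β-shaped index, collar allowance `B_∂·Φ₀`).  Cell `ym3-torus` (HUMAN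
RULING D-0037: YM₃ on T³ is ladder rung R3 — NOT d = 4, NOT infinite volume, NOT a mass gap, NOT the Clay problem), width seat `ym-ust-19200-w3` gen 9.  `--supports
stmt-QuantumFields-19200 --as helper`; THEOREMS ONLY (0 `def`, 0 `sorry`); count-neutral; nothing here claims the displayed sockets, the stub, the crux or the gap.

WHAT.  ★★★ `siteRows_of_socketsTγ`: CONCLUSION = ✓p668452 `siteRows_of_socketsT`'s 22-row ∃-body LETTER FOR LETTER; antecedents = ✓p668452's with (a) `hT4T ↦ hT4Tγ`
(Theorem 4's datum socket WITH SUPPORT CLAUSE, read by ✓(γ-3a) `siteDatum_of_T4Tγ`); (b) `H59 ↦ H59γ` (∀`gJ`∕`g′` closure of T4γ ✓`siteSizeRows_of_topRows_γ`'s binder: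
support antecedent, class `cubeLamBP′ ∪ {level-0 CrossB □₀}`, `+ B_∂·Φ₀`); (c) `SB9 hα₀9 hcs9 ↦ hBbd hBd` + the datum-free socket `H59Dγ` (Theorem 4's FLAT two-member (1.59)
clause at truncation `K − n − 1`, ∀(`W`, `A′`)-closed; read at the datum via ✓(γ-3b) `datumRowsγ` into ✓(γ-2c) `siteTop_of_datum_γ`'s `H59Dβm`; pluggable by lit's flat theorem
✓`sc4_cubeMember_of_ineq159Printed` ∘ ✓`ineq159FlatCubeMemberPrinted_holds_L3`, by `SockB9P3D4β` at `(ε₀, c⋆, U₀ := 1)`, or by the Prop-6 junction); (d) windows + the γ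
rows `hα3γ hα4γ h16γ hsmallγ hc₃γ hsmallPγ hc₃Pγ h16Pγ`, `hC₂` γ-shaped (HARVEST-v2γ ✓p679383), T4γ's β rows discharged inside at `aβ := s` (✓(γ-3b)); (e) (LEAD-H WORD 25)
`HTOP` VERBATIM (inner top class, ε₁-route; (1.42) discharged inside by ✓(γ-3c) `H42_of_rows_γ` over ★w3-20520 g8's ✓`H42_top_guarded_γ`) + ONE displayed residual
`H42topCrossL` = [Balaban1985RegularSpaces] (1.42) at the knit gauge on the level-`k` COLLAR bonds `cubeLamBP′ … k k k ∖ cubeLamB … k k k`, ∀`gJ`∕`g′`∕(`u`, `V′`, `A′`)-closed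
(print's mechanism there = (1.29) at level `k − 1`; «(M2) mixed-end top (1.42)» OPEN; A6 ✓`hcross_trivial_datum`).  A6 GUARD (WORD 17): `H59γ`∕`H59Dγ` consumed at
(β-shaped clause of `SockB9P3D4β`, `cubeLamBP′`, truncation `K − n`∕`K − n − 1`), witnessed by lit ✓`sockB9P3D4γ_at_nonvacuous_cubeLamBP'_zero`, inhabited at `U = 1`; NOT the
refuted `SockH59`∕`SockB9P3D4`∕`cubeLamB`-β currencies.  HONEST SCOPE: by-name composition + window arithmetic; nothing of Prop. 3∕5, Theorem 4, [4] Thm 3.3 or the stub proved.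

References: T. Bałaban, CMP **99** (1985) 75–102 [Balaban1985RegularSpaces] (Prop. 5 (1.106)–(1.109) p.94, Thm 4 p.88, Prop. 3 (1.36)–(1.42) pp.82–83, (1.57)–(1.59)
p.86, (1.131) p.99); CMP **99** (1985) 389–434 [Balaban1985BackgroundPropagators] (Thm 3.1 p.397, Thm 3.3 p.398); CMP **96** (1984) 223–250 [Balaban1984PropagatorsII]
(Prop. 4, (2.3) p.224); CMP **102** (1985) 277–309 [Balaban1985Variational] ((150)–(156) pp.301–302); CMP **98** (1985) 17–51 [Balaban1985Averaging] ((19)–(23) pp.20–21).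
-/

set_option autoImplicit false

noncomputable section

open scoped BigOperators Matrix.Norms.L2Operator
open NormedSpace  open Complex (I)

namespace Summit.QuantumFields.YangMills.Theorems.HalvingHSiteRowsOfSocketsTGamma

open Literature.MathematicalPhysics.QuantumFieldTheory.Balaban1983to89  open Literature.MathematicalPhysics.QuantumFieldTheory.Balaban1983to89.T3ContinuumYM3Torus
open Literature.MathematicalPhysics.QuantumFieldTheory.Balaban1983to89.T3PrintedRegularMinimiser (RegPr regFibrePr)  open MatrixLog (mlog)  open B5Eq118OneStroke (iterBlockOf)
open B7Prop1Explicit (e expUnit)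
open B7Prop1Explicit renaming Site → LSite
open B7Prop2Explicit (unitaryUnits C0 c2' avgIter)  open B7Prop2SpecialUnitary (specialUnitaryUnits mem_specialUnitaryUnits specialUnitaryUnits_le_unitaryUnits)
open B7Prop3Flat (c3)  open B7Prop10General (C6 C4G)  open B7Prop9Flat (C5')  open B7Prop1Local (InBox loK bondHiK)
open B7Eq78Linearization (conjR zdBlocking QprimeIter)  open B7Eq92Concrete (mgauge)  open B8Ineq130 (tlo thi)  open B8Ineq132 (covDerivFwd InAk)
open B8Eq119TwistedAxial (Restr129 InAx bgT)  open B8Eq131Cubes (cube gs tLo tHi)  open B8Eq131CubesAdmissible (cubeFam)  open B8CubeMemberZd (cubeLamS cubeLamB)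
open B8Eq184Proof (gaugeExp cfgExp)  open B8Eq182Proof (gAd)  open B8Eq188Proof (frakF3)  open B8Eq140Level (SideTouches)
open B8Eq146AExpansion (iEta)  open B8Eq138LandauZd (IsLandau138W covDivB covLap QT logCfg)  open B7Prop4GeneralLevels (logCovIter linCovIter)  open B8Eq155JBound (Jcur wsup)
open B8ScaledSupNorm (bondNorm msup)  open B8Ineq125Concrete (C2p)
open B8Eq1117Concrete (XSpace)  open B9SupplySockB9P3ZdBeta (CrossB)  open B9SupplySockB9P3ZdGamma (cubeLamBP')  open B8Ineq132 (BondTouches)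
open HalvingHSiteDatumRowsGamma (datumRowsγ h66_of_towerRow betaScalarRows)  open B8Prop5ContractionKLevel (Bd2 Mc Kc)  open B8LambdaSpaceKLevel (wt)
open B8Eq178Averages (Qnl)  open B8SpecialUnitaryTrace (trCLM trCLM_apply)
open B10Eq27TorusAxialLog (transl rel pull pull_apply unitsField toUField suIncl gaugeActT axialT unitsField_mem_unitaryUnits)  open B15Eq112TorusCover (lift cover)  open Node00 (coverAt)
open LatticeFieldCalculus (siteAvgIter)  open Summit.QuantumFields.YangMills.Theorems.Prop8ChartDoubleBar (dbarIterU vframeU)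
open P1FlatCoreCubeInclusion (corner_of_offset)  open HalvingP1FlatCoreSupplierAssembly (hchartTop_of_hdat hc₁_of_small)
open HalvingHSiteSizeRowsOfTopRowsGamma (siteSizeRows_of_topRows_γ)  open HalvingHSiteTopKnit (hknit_of_descent)
open HalvingHSiteDatumOfSocketsTGamma (siteDatum_of_T4Tγ)  open HalvingHSiteTopH42OfRowsGamma (H42_of_rows_γ)  open B7Prop4Flat (C2 c4)  open HalvingHSiteTopOfDatumGamma (siteTop_of_datum_γ)

variable (F : T3Family) {n K : ℕ}

set_option maxHeartbeats 400000 in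
/-- ★★★ **THE PER-SITE COMPOSER FOR `2 ≤ K − n`, EDITION γ (FILE (γ-3))** — see the module docstring: `hMember`'s 22-row ∃-body VERBATIM at one site from the
displayed windows and the sockets `hT4Tγ H59Dγ SLetτ HTOP H42topCrossL H59γ` (print's split class `cubeLamBP′`, support clauses, collar allowance).
[cite: Balaban1985RegularSpaces, Prop. 5 (1.106)-(1.109) p.94, Thm 4 p.88, Prop. 3 (1.36)-(1.42) pp.82-83, (1.57)-(1.59) p.86, (1.131) p.99; Balaban1985BackgroundPropagators, Thm 3.1 p.397, Thm 3.3 p.398; Balaban1984PropagatorsII, Prop. 4, (2.3) p.224; Balaban1985Variational, (150)-(156) pp.301-302; Balaban1985Averaging, (19)-(23) pp.20-21, (208)-(214) p.50] -/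
theorem siteRows_of_socketsTγ (L : ℕ) (hF : F.L = L) (hnK : n < K) (h2 : 2 ≤ K - n)
    -- `hMember`'s antecedents read at one site
    (ρ S M M' : ℕ) {ρ' : ℕ} (hρ'def : ρ' = ρ + M + L + S) {ε₀ : ℝ} (hε₀ : 0 < ε₀) (hε : 10 ^ 7 * (F.L : ℝ) ^ 3 * ε₀ ≤ 1)
    {s : ℝ} (hsdef : s = (198 + 12 * (((M' : ℝ) - 1) + 4 * ρ')) * ε₀) (hs6 : s ≤ 1 / 6)
    (hroom : 2 * ρ + (M' + 1 + 2 * (M + L + S)) ≤ F.L ^ (F.m + n))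
    (V : GaugeField (F.P n) 0 (Matrix.specialUnitaryGroup (Fin 2) ℂ)) (U : GaugeField (F.P K) 0 (Matrix.specialUnitaryGroup (Fin 2) ℂ))
    (hU : U ∈ regFibrePr F n K hnK.le ε₀ V) (x₀ : Site (F.P K) 0)
    {t : ℤ} (ht0 : 0 ≤ t) (ht : t ≤ (M' : ℤ) - 1)
    {a : LSite (F.P K).d} (hadef : a = fun μ => ((iterBlockOf (K - n) x₀ μ).val : ℤ) - t)
    -- the schedule letters, socket constants, size letter `Bsz`, and ALL scalar windows (Prop. 3 at `(ε₀, c⋆)`∕`(ε₀, 2(L·c⋆)+8α₄)`, JOIN, family, torus, trace; + the γ rows) — DISPLAYED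
    {α₁ B₀ B₀' cstar α₄ C₂ σ δ ω τ₀ cB cA cDA Cb Cl B₀'H B₂' BG BR Bbd Bsz : ℝ} {m₀ : ℕ}
    (hα₁ : 0 < α₁) (hB₀ : 0 < B₀) (hB₀' : 0 < B₀') (hB₀'H : 0 < B₀'H) (hB₂' : 0 ≤ B₂') (hBG : 0 ≤ BG) (hBR : 0 ≤ BR) (hsα₁ : s ≤ α₁)
    (hc : cstar = 5 * ((F.P K).d : ℝ) * (F.P K).L * B₀ * (ε₀ + α₁))
    (hα₄ : α₄ = 8 * B₀' * (5 * ((F.P K).d : ℝ) * (F.P K).L * B₀) * (ε₀ + α₁)) (hs₂ : (F.P K).L * cstar ≤ 1 / 12)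
    (hside₀ : 36 * (F.P K).d * B₀ * cstar ≤ 1 / 2)
    (hC₂ : 8 * (131072 * (((F.P K).d : ℝ) + 1) ^ 2) * Real.exp (4 * (800 * (((F.P K).d : ℝ) + 1) ^ 2 * (((F.P K).d : ℝ) + 4)) * (((F.P K).L : ℝ) ^ 2 * ε₀)) * ((F.P K).L : ℝ) ^ 2 ≤ C₂)
    (h61₀ : 2 * cstar ^ 2 + 20 * (F.P K).d * ε₀ * cstar + 2 * C₂ * cstar ^ 2 ≤ ε₀ + α₁) (hsmall₁ : ((F.P K).d : ℝ) * (F.P K).L * α₁ ≤ 1 / 8)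
    (hα3 : C0 (F.P K).d * ε₀ ≤ 1 / 3) (hα4 : 4 * ε₀ ≤ c2' (F.P K).d (F.P K).L)
    -- EDITION γ: [3] Prop. 4's windows ONE LEVEL LOWER, at `(L²ε₀, L·c⋆)` (the γ JOIN's) and at `(L²ε₀, L·(2(L·c⋆) + 8α₄))` (T4γ's)
    (hα3γ : C0 (F.P K).d * (((F.P K).L : ℝ) ^ 2 * ε₀) ≤ 1 / 3) (hα4γ : 4 * (((F.P K).L : ℝ) ^ 2 * ε₀) ≤ c2' (F.P K).d (F.P K).L) (h16γ : 16 * (((F.P K).L : ℝ) * cstar) ≤ 1)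
    (hsmallγ : Real.exp (4 * (800 * (((F.P K).d : ℝ) + 1) ^ 2 * (((F.P K).d : ℝ) + 4)) * (((F.P K).L : ℝ) ^ 2 * ε₀))
      * (1 + 8 * (131072 * (((F.P K).d : ℝ) + 1) ^ 2) * (((F.P K).L : ℝ) * cstar)) ≤ 2)
    (hc₃γ : 2 * (((F.P K).L : ℝ) * cstar) ≤ c3 (F.P K).d (F.P K).L)
    (hsmallPγ : Real.exp (4 * (800 * (((F.P K).d : ℝ) + 1) ^ 2 * (((F.P K).d : ℝ) + 4)) * (((F.P K).L : ℝ) ^ 2 * ε₀))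
      * (1 + 8 * (131072 * (((F.P K).d : ℝ) + 1) ^ 2) * (((F.P K).L : ℝ) * (2 * ((F.P K).L * cstar) + 8 * α₄))) ≤ 2)
    (hc₃Pγ : 2 * (((F.P K).L : ℝ) * (2 * ((F.P K).L * cstar) + 8 * α₄)) ≤ c3 (F.P K).d (F.P K).L)
    (h16Pγ : 16 * (((F.P K).L : ℝ) * (2 * ((F.P K).L * cstar) + 8 * α₄)) ≤ 1)
    (h16 : 16 * (2 * ((F.P K).L * cstar) + 8 * α₄) ≤ 1) (hd5 : 5 * (2 * ((F.P K).L * cstar) + 8 * α₄) * (((F.P K).d : ℝ) - 1) ≤ 4)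
    (hside : 36 * (F.P K).d * B₀ * (2 * ((F.P K).L * cstar) + 8 * α₄) ≤ 1 / 2)
    (h50 : 50 * (F.P K).d * (2 * ((F.P K).L * cstar) + 8 * α₄) ≤ 1)
    (h61 : 2 * (2 * ((F.P K).L * cstar) + 8 * α₄) ^ 2 + 20 * (F.P K).d * ε₀ * (2 * ((F.P K).L * cstar) + 8 * α₄) + 2 * C₂ * (2 * ((F.P K).L * cstar) + 8 * α₄) ^ 2 ≤ ε₀ + α₁)
    (hcBlo : (F.P K).L * cstar ≤ cB) (hcAlo : (F.P K).L * cstar ≤ cA) (hcDAlo : ((F.P K).d : ℝ) * ((F.P K).L : ℝ) ^ 2 * cstar ≤ cDA)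
    (hsmall : Real.exp (4 * (800 * (((F.P K).d : ℝ) + 1) ^ 2 * (((F.P K).d : ℝ) + 4)) * ε₀) * (1 + 8 * (131072 * (((F.P K).d : ℝ) + 1) ^ 2) * cB) ≤ 2)
    (hc₃ : 2 * cB ≤ c3 (F.P K).d (F.P K).L) (hsc : 2048 * ((F.P K).d : ℝ) * cB ≤ 1) (hα₃' : 40 * (F.P K).d * cB ≤ 1 / 200)
    (hs₁ : 200 * C6 (F.P K).d * (2 * α₄) ≤ 1) (hs₂' : 12000 * (((F.P K).d : ℝ) + 1) * (F.P K).L * (2 * α₄) ≤ 1)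
    (hs₃ : C4G (F.P K).d (F.P K).L * (ε₀ + 40 * (F.P K).d * cB + 4 * (2 * α₄)) ≤ 1)
    (hs₄ : 1024 * (((F.P K).d : ℝ) + 1) * (((F.P K).d : ℝ) + 4) * (F.P K).L ^ 2 * ε₀ ≤ 1)
    (hs₅ : 32 * (((F.P K).d : ℝ) + 1) ^ 2 * C6 (F.P K).d * (F.P K).L ^ 2 * ε₀ ≤ 1)
    (hs₆ : 16 * (F.P K).d * C5' (F.P K).d * C6 (F.P K).d * ((F.P K).L : ℝ) ^ 2 * ε₀ ≤ 1) (hs₇ : 8 * (F.P K).d * C6 (F.P K).d * (F.P K).L * ε₀ ≤ 1)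
    (hprod8 : 2 * C6 (F.P K).d * (40 * (F.P K).d * cB + 4 * α₄) ≤ 1 / 8)
    (hα70 : α₄ ≤ 1 / 70) (hcA0 : 0 ≤ cA) (hcA12 : cA ≤ 1 / 12) (hcA13 : cA ≤ 1 / 13)
    (hCblo : C2p (F.P K).d * (40 * (F.P K).d * cB + α₄) * α₄ ≤ Cb) (hCllo : 2 * C2p (F.P K).d * (40 * (F.P K).d * cB + 2 * α₄) ≤ Cl)
    (hCbρ : Cb ≤ α₄ / (2 * B₀'H)) (hClB : Cl * B₀'H ≤ 1 / 2)
    (hσ : 2 * (F.P K).L * cstar ≤ σ)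
    (hδ : δ = 8 * ((((F.P K).d + 2) * (F.P K).L : ℕ) : ℝ) * σ) (hω : ω = ((F.P K).d : ℝ) * (F.P K).L * α₄ / 2) (hτ₀ : τ₀ = 16 * m₀ * σ)
    (hbudget : 8 * 3800 * ((((F.P K).d + 2) * (F.P K).L : ℕ) : ℝ) ^ 2 * σ ≤ 1) (hm : 32 * (m₀ : ℝ) * σ ≤ 1)
    (hm₀ : (F.P K).d * (M' + ρ') ≤ m₀) (hr : 160 * (α₄ + δ + 11 * ω) ≤ 1 / 4)
    (hCb₀ : 640 * (α₄ + δ + 5 * ω) * ω ≤ Cb) (hCl₀ : 10240 * (((F.P K).d : ℝ) * (F.P K).L) * (α₄ + δ + 11 * ω) ≤ Cl)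
    (hwin : ∀ τ : ℝ, 0 ≤ τ → τ ≤ τ₀ → B₀'H * τ < α₄ / 4 ∧ α₄ / 4 + B₀'H * (Cb + τ) ≤ 1 / 24 ∧ α₄ / 4 + B₀'H * (Cb + τ) ≤ 1 / 140 ∧
      10 * (α₄ / 4 + B₀'H * (Cb + τ)) * BR ≤ 1 / 2 ∧ B₀'H * (Cb + τ) ≤ 3 * α₄ / 4 ∧ BG * Mc (F.P K).d BR (α₄ / 4 + B₀'H * (Cb + τ)) cA (B₂' * (Cb + τ)) cDA ≤ α₄ / 4 ∧
      BG * Kc (F.P K).d BR (α₄ / 4 + B₀'H * (Cb + τ)) cA (B₂' * (Cb + τ)) cDA (B₂' * (2 * Cl)) (1 + B₀'H * (2 * Cl)) (1 + B₀'H * (2 * Cl)) ≤ 1 / 2)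
    (hcsB : cstar ≤ Bsz * ε₀)
    -- the knit ∕ read ∕ (1.42) windows of ✓p666867 (schedule letters; `r := e^{2α₄}((e^{c₁} − 1) + α₄L^{−k})`, `c₁ := c⋆·L^{−(k−1)}`) and the top-log letter `ttop`
    (hkb : (2 * ((F.P K).L * cstar) + 8 * α₄) ≤ c4 (F.P K).d) (hbudget42 : 243200 * ((((F.P K).d + 2) * (F.P K).L : ℕ) : ℝ) ^ 2 * (2 * ((F.P K).L * cstar) + 8 * α₄) ≤ 1)
    {ttop : ℝ} (hr42 : Real.exp (2 * α₄) * ((Real.exp (cstar * (((F.P K).L : ℝ) ^ (K - n - 1))⁻¹) - 1) + α₄ * (((F.P K).L : ℝ) ^ (K - n))⁻¹) ≤ 1 / 2)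
    (hr2 : 2 * (Real.exp (2 * α₄) * ((Real.exp (cstar * (((F.P K).L : ℝ) ^ (K - n - 1))⁻¹) - 1) + α₄ * (((F.P K).L : ℝ) ^ (K - n))⁻¹)) ≤ (2 * ((F.P K).L * cstar) + 8 * α₄) * (((F.P K).L : ℝ) ^ (K - n))⁻¹)
    (hwin42 : ttop + (C2 (F.P K).d + 64 * 60800 * ((((F.P K).d + 2) * (F.P K).L : ℕ) : ℝ) ^ 2) * (2 * ((F.P K).L * cstar) + 8 * α₄) ^ 2 < 2 * ((F.P K).d : ℝ) * (F.P K).L * α₁)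
    -- SOCKET `HTOP` (design (D2)): top double-bar logs of `(U♯)^{g′}` at the knit gauge `≤ t`, ∀-closed over the witnesses with ∃-body rows 1,2,4–9,14,15,19 as antecedents
    (HTOP : ∀ (gJ : GaugeTransf (F.P K) 0 (Matrix.specialUnitaryGroup (Fin 2) ℂ)) (u₁ : LSite (F.P K).d → (Matrix (Fin 2) (Fin 2) ℂ)ˣ)
        (W : LSite (F.P K).d → Fin (F.P K).d → (Matrix (Fin 2) (Fin 2) ℂ)ˣ) (A : LSite (F.P K).d → Fin (F.P K).d → Matrix (Fin 2) (Fin 2) ℂ) (c₁ c' : ℝ)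
        (κf : (Site (F.P K) 0 → Matrix (Fin 2) (Fin 2) ℂ) → (i : ℕ) → GaugeTransf (F.P K) i (Matrix (Fin 2) (Fin 2) ℂ)ˣ) (lam : LSite (F.P K).d → Matrix (Fin 2) (Fin 2) ℂ),
      (∀ z, ((u₁ z : (Matrix (Fin 2) (Fin 2) ℂ)ˣ) : Matrix (Fin 2) (Fin 2) ℂ) ∈ Matrix.specialUnitaryGroup (Fin 2) ℂ) →
      mgauge (1 : LSite (F.P K).d → Fin (F.P K).d → (Matrix (Fin 2) (Fin 2) ℂ)ˣ) u₁ W = pull (unitsField (toUField (GaugeField.gaugeAct gJ U))) 0 →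
      0 ≤ c' → 8 * 3800 * ((((F.P K).d + 2) * (F.P K).L : ℕ) : ℝ) ^ 2 * c' ≤ 1 → Real.exp c₁ - 1 ≤ ((F.L : ℝ)⁻¹) ^ (K - n) * c' →
      (∀ z ∈ cube (F.P K).L a M' ρ' (K - n) (K - n), ∀ ν : Fin (F.P K).d, W z ν = cfgExp (((F.L : ℝ)⁻¹) ^ (K - n)) A z ν ∧ ((F.L : ℝ)⁻¹) ^ (K - n) * ‖A z ν‖ ≤ c₁) →
      (∀ (m : Site (F.P K) 0 → Matrix (Fin 2) (Fin 2) ℂ) (i : ℕ) (y : Site (F.P K) (i + 1)), κf m (i + 1) y = (vframeU (gaugeActT (κf m i) (dbarIterU i (gaugeActT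
          (fun s => (u₁ (lift (F.P K) x₀ + rel x₀ s))⁻¹ * Unitary.toUnits (suIncl (gJ s)) : GaugeTransf (F.P K) 0 (Matrix (Fin 2) (Fin 2) ℂ)ˣ)
          (unitsField (toUField U))))) y)⁻¹ * κf m i (emb y) * vframeU (dbarIterU i (gaugeActT
            (fun s => (u₁ (lift (F.P K) x₀ + rel x₀ s))⁻¹ * Unitary.toUnits (suIncl (gJ s)) : GaugeTransf (F.P K) 0 (Matrix (Fin 2) (Fin 2) ℂ)ˣ) (unitsField (toUField U)))) y) →
      (∀ (m : Site (F.P K) 0 → Matrix (Fin 2) (Fin 2) ℂ) (x : Site (F.P K) 0), ((κf m 0 x : (Matrix (Fin 2) (Fin 2) ℂ)ˣ) : Matrix (Fin 2) (Fin 2) ℂ) = exp (m x)) →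
      (∀ x, IsSelfAdjoint (lam x)) → (∀ x, (lam x).trace = 0) → (∀ yc ∈ cubeLamS (F.P K).L a M' ρ' (K - n) (K - n) (K - n),
        κf (((-I) • lam) ∘ fun s : Site (F.P K) 0 => lift (F.P K) x₀ + rel x₀ s) (K - n) (coverAt (F.P K) (K - n) yc) = axialT (dbarIterU (K - n) (gaugeActT
            (fun s => (u₁ (lift (F.P K) x₀ + rel x₀ s))⁻¹ * Unitary.toUnits (suIncl (gJ s)) : GaugeTransf (F.P K) 0 (Matrix (Fin 2) (Fin 2) ℂ)ˣ)
            (unitsField (toUField U)))) (iterBlockOf (K - n) x₀) (coverAt (F.P K) (K - n) yc)) → ∀ c ∈ cubeLamB (F.P K).L a M' ρ' (K - n) (K - n) (K - n),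
        ‖mlog ((dbarIterU (K - n) (gaugeActT (fun s => ((u₁ * gaugeExp lam) (lift (F.P K) x₀ + rel x₀ s))⁻¹ * Unitary.toUnits (suIncl (gJ s)) :
              GaugeTransf (F.P K) 0 (Matrix (Fin 2) (Fin 2) ℂ)ˣ) (unitsField (toUField U)))
            ⟨coverAt (F.P K) (K - n) c.1, c.2⟩ : (Matrix (Fin 2) (Fin 2) ℂ)ˣ) : Matrix (Fin 2) (Fin 2) ℂ)‖ ≤ ttop)
    -- SOCKET `H42topCrossL` (LEAD-H WORD 25, the ONE displayed residual): (1.42) at the knit gauge on the level-`k` COLLAR bonds of print's class, ∀ `gJ` (three guards) ∕ `g′ u V′ A′`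
    (H42topCrossL : ∀ (gJ : GaugeTransf (F.P K) 0 (Matrix.specialUnitaryGroup (Fin 2) ℂ)),
      InAk (F.P K).L (K - n) (((F.L : ℝ)⁻¹) ^ (K - n)) ε₀ (fun _ => (Set.univ : Set (LSite (F.P K).d))) (pull (unitsField (toUField (GaugeField.gaugeAct gJ U))) 0) →
      (∀ m', m' ≤ K - n → ∀ Λ : ℕ → Set (LSite (F.P K).d), InAx (F.P K).L m' Λ (1 : LSite (F.P K).d → Fin (F.P K).d → (Matrix (Fin 2) (Fin 2) ℂ)ˣ) (pull (unitsField (toUField (GaugeField.gaugeAct gJ U))) 0)) →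
      (∀ m', m' ≤ K - n → ∀ (x : LSite (F.P K).d) (ν : Fin (F.P K).d), tlo (F.P K).L (tLo a ρ') m' ≤ x → x + e ν ≤ thi (F.P K).L (tHi a M' ρ') m' →
        ‖((avgIter (F.P K).L (pull (unitsField (toUField (GaugeField.gaugeAct gJ U))) 0) (K - n - m') x ν : (Matrix (Fin 2) (Fin 2) ℂ)ˣ) : Matrix (Fin 2) (Fin 2) ℂ) - 1‖ < s) →
      ∀ (g' : GaugeTransf (F.P K) 0 (Matrix (Fin 2) (Fin 2) ℂ)ˣ) (u : LSite (F.P K).d → (Matrix (Fin 2) (Fin 2) ℂ)ˣ) (V' : LSite (F.P K).d → Fin (F.P K).d → (Matrix (Fin 2) (Fin 2) ℂ)ˣ)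
        (A' : LSite (F.P K).d → Fin (F.P K).d → (Matrix (Fin 2) (Fin 2) ℂ)),
      (∀ x, u x ∈ unitaryUnits (Matrix (Fin 2) (Fin 2) ℂ)) → mgauge (1 : LSite (F.P K).d → Fin (F.P K).d → (Matrix (Fin 2) (Fin 2) ℂ)ˣ) u V' = (pull (unitsField (toUField (GaugeField.gaugeAct gJ U))) 0) →
      Restr129 (F.P K).L (K - n) (Function.update (cubeLamS (F.P K).L a M' ρ' (K - n) (K - n)) (K - n) ∅) (1 : LSite (F.P K).d → Fin (F.P K).d → (Matrix (Fin 2) (Fin 2) ℂ)ˣ) u →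
      (IsLandau138W (F.P K).L (K - n) (((F.L : ℝ)⁻¹) ^ (K - n)) ((cubeFam false (F.P K).L a M' ρ' (K - n)) 0) (cubeLamS (F.P K).L a M' ρ' (K - n) (K - n)) (1 : LSite (F.P K).d → Fin (F.P K).d → (Matrix (Fin 2) (Fin 2) ℂ)ˣ) V' ∧
        (∀ c ∈ (cubeLamB (F.P K).L a M' ρ' (K - n) (K - n)) (K - n), ∀ (y : LSite (F.P K).d) (τ : Fin (F.P K).d),
          InBox (loK (F.P K).L (K - n) c.1) (bondHiK (F.P K).L (K - n) c.1 c.2) y → InBox (loK (F.P K).L (K - n) c.1) (bondHiK (F.P K).L (K - n) c.1 c.2) (y + e τ) →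
          V' y τ = gaugeActT g' (unitsField (toUField U)) ⟨cover (F.P K) y, τ⟩)) → (∀ y τ, IsSelfAdjoint (A' y τ)) →
      (∀ j, j ≤ K - n → ∀ y τ, SideTouches ((cubeFam false (F.P K).L a M' ρ' (K - n)) j) y τ →
        V' y τ = cfgExp (((F.L : ℝ)⁻¹) ^ (K - n)) A' y τ ∧ ‖A' y τ‖ ≤ (2 * ((F.P K).L * cstar) + 8 * α₄) * (((F.P K).L : ℝ) ^ j * (((F.L : ℝ)⁻¹) ^ (K - n)))⁻¹) →
      (∀ y τ, (∀ j, j ≤ K - n → ¬ SideTouches ((cubeFam false (F.P K).L a M' ρ' (K - n)) j) y τ) → A' y τ = 0) →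
      ∀ c ∈ (cubeLamBP' (F.P K).L a M' ρ' (K - n) (K - n)) (K - n), c ∉ (cubeLamB (F.P K).L a M' ρ' (K - n) (K - n)) (K - n) →
        ‖logCovIter (F.P K).L (1 : LSite (F.P K).d → Fin (F.P K).d → (Matrix (Fin 2) (Fin 2) ℂ)ˣ) (iEta (((F.L : ℝ)⁻¹) ^ (K - n)) A') (K - n) c.1 c.2‖ < 2 * (F.P K).d * (F.P K).L * α₁)
    -- SOCKET `hT4Tγ`: Theorem 4's datum WITH ITS SUPPORT CLAUSE at every level for the pre-gauged field, ∀-closed over the member's `SU(2)` gauge UNDER J3's four rows (✓(γ-3a))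
    (hT4Tγ : ∀ gJ : GaugeTransf (F.P K) 0 (Matrix.specialUnitaryGroup (Fin 2) ℂ),
      InAk (F.P K).L (K - n) (((F.L : ℝ)⁻¹) ^ (K - n)) ε₀ (fun _ => (Set.univ : Set (LSite (F.P K).d))) (pull (unitsField (toUField (GaugeField.gaugeAct gJ U))) 0) →
      (∀ m', m' ≤ K - n → ∀ Λ : ℕ → Set (LSite (F.P K).d),
        InAx (F.P K).L m' Λ (1 : LSite (F.P K).d → Fin (F.P K).d → (Matrix (Fin 2) (Fin 2) ℂ)ˣ) (pull (unitsField (toUField (GaugeField.gaugeAct gJ U))) 0)) →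
      (∀ m', m' ≤ K - n → ∀ (x : LSite (F.P K).d) (ν : Fin (F.P K).d), tlo (F.P K).L (tLo a ρ') m' ≤ x → x + e ν ≤ thi (F.P K).L (tHi a M' ρ') m' →
        ‖((avgIter (F.P K).L (pull (unitsField (toUField (GaugeField.gaugeAct gJ U))) 0) (K - n - m') x ν : (Matrix (Fin 2) (Fin 2) ℂ)ˣ) : Matrix (Fin 2) (Fin 2) ℂ) - 1‖ < s) →
      (∀ (x : LSite (F.P K).d) (ν : Fin (F.P K).d), tlo (F.P K).L (tLo a ρ') (K - n) ≤ x → x + e ν ≤ thi (F.P K).L (tHi a M' ρ') (K - n) →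
        ‖((pull (unitsField (toUField (GaugeField.gaugeAct gJ U))) 0 x ν : (Matrix (Fin 2) (Fin 2) ℂ)ˣ) : Matrix (Fin 2) (Fin 2) ℂ) - 1‖ < s) →
      ∀ m, m ≤ K - n → ∃ u : LSite (F.P K).d → (Matrix (Fin 2) (Fin 2) ℂ)ˣ,
        (∀ x, ((u x : (Matrix (Fin 2) (Fin 2) ℂ)ˣ) : Matrix (Fin 2) (Fin 2) ℂ) ∈ Matrix.specialUnitaryGroup (Fin 2) ℂ) ∧
        (∀ x, x ∉ cubeFam false (F.P K).L a M' ρ' (K - n) 0 → u x = 1) ∧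
        Restr129 (F.P K).L m (cubeLamS (F.P K).L a M' ρ' (K - n) m) (1 : LSite (F.P K).d → Fin (F.P K).d → (Matrix (Fin 2) (Fin 2) ℂ)ˣ) u ∧
        ∃ W : LSite (F.P K).d → Fin (F.P K).d → (Matrix (Fin 2) (Fin 2) ℂ)ˣ,
          mgauge (1 : LSite (F.P K).d → Fin (F.P K).d → (Matrix (Fin 2) (Fin 2) ℂ)ˣ) u W = pull (unitsField (toUField (GaugeField.gaugeAct gJ U))) 0 ∧
          (1 ≤ m → IsLandau138W (F.P K).L m (((F.L : ℝ)⁻¹) ^ (K - n)) (cubeFam false (F.P K).L a M' ρ' (K - n) 0) (cubeLamS (F.P K).L a M' ρ' (K - n) m)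
            (1 : LSite (F.P K).d → Fin (F.P K).d → (Matrix (Fin 2) (Fin 2) ℂ)ˣ) W) ∧ ∃ A : LSite (F.P K).d → Fin (F.P K).d → Matrix (Fin 2) (Fin 2) ℂ, ∀ j, j ≤ m →
            ∀ b ∈ {b : LSite (F.P K).d × Fin (F.P K).d | SideTouches (cubeFam false (F.P K).L a M' ρ' (K - n) j) b.1 b.2},
              W b.1 b.2 = cfgExp (((F.L : ℝ)⁻¹) ^ (K - n)) A b.1 b.2 ∧ IsSelfAdjoint (A b.1 b.2) ∧ ‖A b.1 b.2‖ ≤ cstar * (((F.P K).L : ℝ) ^ j * ((F.L : ℝ)⁻¹) ^ (K - n))⁻¹)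
    -- EDITION γ: collar constant `B_∂` + SOCKET `H59Dγ`: Theorem 4's FLAT two-member (1.59) clause at truncation `K − n − 1` ([4] Thm 3.3 for `G(1)`, print's split class), ∀(`W`, `A′`)-closed
    (hBbd : 0 ≤ Bbd) (hBd : 4 * Bbd ≤ (((F.P K).d : ℝ) * (F.P K).L - 1) * B₀)
    (H59Dγ : ∀ (W : LSite (F.P K).d → Fin (F.P K).d → (Matrix (Fin 2) (Fin 2) ℂ)ˣ) (A' : LSite (F.P K).d → Fin (F.P K).d → (Matrix (Fin 2) (Fin 2) ℂ)),
      (∀ x κ, W x κ ∈ unitaryUnits (Matrix (Fin 2) (Fin 2) ℂ)) → InAk (F.P K).L (K - n - 1) (((F.L : ℝ)⁻¹) ^ (K - n)) ε₀ (cubeFam false (F.P K).L a M' ρ' (K - n)) W →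
      IsLandau138W (F.P K).L (K - n - 1) (((F.L : ℝ)⁻¹) ^ (K - n)) ((cubeFam false (F.P K).L a M' ρ' (K - n)) 0) (cubeLamS (F.P K).L a M' ρ' (K - n) (K - n - 1)) (1 : LSite (F.P K).d → Fin (F.P K).d → (Matrix (Fin 2) (Fin 2) ℂ)ˣ) W →
      (∀ y τ, IsSelfAdjoint (A' y τ)) → (∀ j, j ≤ K - n - 1 → ∀ (y : LSite (F.P K).d) (τ : Fin (F.P K).d), SideTouches ((cubeFam false (F.P K).L a M' ρ' (K - n)) j) y τ →
        W y τ = cfgExp (((F.L : ℝ)⁻¹) ^ (K - n)) A' y τ ∧ ‖A' y τ‖ ≤ cstar * (((F.P K).L : ℝ) ^ j * (((F.L : ℝ)⁻¹) ^ (K - n)))⁻¹) →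
      (∀ (y : LSite (F.P K).d) (τ : Fin (F.P K).d), (∀ j, j ≤ K - n - 1 → ¬ SideTouches ((cubeFam false (F.P K).L a M' ρ' (K - n)) j) y τ) → A' y τ = 0) →
      msup (F.P K).L (K - n - 1) (((F.L : ℝ)⁻¹) ^ (K - n)) (-(1 : ℝ)) (fun j (b : LSite (F.P K).d × Fin (F.P K).d) => SideTouches ((cubeFam false (F.P K).L a M' ρ' (K - n)) j) b.1 b.2) (fun b => A' b.1 b.2)
          ≤ B₀ * (bondNorm (F.P K).L (K - n - 1) (((F.L : ℝ)⁻¹) ^ (K - n)) (-(3 : ℝ)) (cubeFam false (F.P K).L a M' ρ' (K - n)) (fun x μ => Jcur (((F.L : ℝ)⁻¹) ^ (K - n)) (1 : LSite (F.P K).d → Fin (F.P K).d → (Matrix (Fin 2) (Fin 2) ℂ)ˣ) A' μ x)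
            + wsup 1 (fun p : {p : ℕ × (LSite (F.P K).d × Fin (F.P K).d) // p.1 ≤ K - n - 1 ∧ (p.2 ∈ (cubeLamBP' (F.P K).L a M' ρ' (K - n) (K - n - 1)) p.1 ∨ (p.1 = 0 ∧ CrossB ((cubeFam false (F.P K).L a M' ρ' (K - n)) 0) p.2))} => linCovIter (F.P K).L (1 : LSite (F.P K).d → Fin (F.P K).d → (Matrix (Fin 2) (Fin 2) ℂ)ˣ) (iEta (((F.L : ℝ)⁻¹) ^ (K - n)) A') p.1.1 p.1.2.1 p.1.2.2))
            + Bbd * msup (F.P K).L (K - n - 1) (((F.L : ℝ)⁻¹) ^ (K - n)) (-(1 : ℝ)) (fun j (b : LSite (F.P K).d × Fin (F.P K).d) => j = 0 ∧ SideTouches ((cubeFam false (F.P K).L a M' ρ' (K - n)) 0) b.1 b.2 ∧ ¬ BondTouches ((cubeFam false (F.P K).L a M' ρ' (K - n)) 0) b.1 b.2) (fun b => A' b.1 b.2) ∧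
        msup (F.P K).L (K - n - 1) (((F.L : ℝ)⁻¹) ^ (K - n)) (-(2 : ℝ)) (fun j (t : Fin (F.P K).d × Fin (F.P K).d × LSite (F.P K).d) => SideTouches ((cubeFam false (F.P K).L a M' ρ' (K - n)) j) t.2.2 t.2.1) (fun t => covDerivFwd (((F.L : ℝ)⁻¹) ^ (K - n)) (1 : LSite (F.P K).d → Fin (F.P K).d → (Matrix (Fin 2) (Fin 2) ℂ)ˣ) t.1 (fun z => A' z t.2.1) t.2.2)
          ≤ B₀ * (bondNorm (F.P K).L (K - n - 1) (((F.L : ℝ)⁻¹) ^ (K - n)) (-(3 : ℝ)) (cubeFam false (F.P K).L a M' ρ' (K - n)) (fun x μ => Jcur (((F.L : ℝ)⁻¹) ^ (K - n)) (1 : LSite (F.P K).d → Fin (F.P K).d → (Matrix (Fin 2) (Fin 2) ℂ)ˣ) A' μ x)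
            + wsup 1 (fun p : {p : ℕ × (LSite (F.P K).d × Fin (F.P K).d) // p.1 ≤ K - n - 1 ∧ (p.2 ∈ (cubeLamBP' (F.P K).L a M' ρ' (K - n) (K - n - 1)) p.1 ∨ (p.1 = 0 ∧ CrossB ((cubeFam false (F.P K).L a M' ρ' (K - n)) 0) p.2))} => linCovIter (F.P K).L (1 : LSite (F.P K).d → Fin (F.P K).d → (Matrix (Fin 2) (Fin 2) ℂ)ˣ) (iEta (((F.L : ℝ)⁻¹) ^ (K - n)) A') p.1.1 p.1.2.1 p.1.2.2))
            + Bbd * msup (F.P K).L (K - n - 1) (((F.L : ℝ)⁻¹) ^ (K - n)) (-(1 : ℝ)) (fun j (b : LSite (F.P K).d × Fin (F.P K).d) => j = 0 ∧ SideTouches ((cubeFam false (F.P K).L a M' ρ' (K - n)) 0) b.1 b.2 ∧ ¬ BondTouches ((cubeFam false (F.P K).L a M' ρ' (K - n)) 0) b.1 b.2) (fun b => A' b.1 b.2))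
    -- SOCKET: the [4] LETTERS at `(K − n, U₀ := 1)` as ONE package (✓p654110's `SLetτ`; VERBATIM ✓p659785∕✓p660425's)
    (SLetτ : ∃ (g Δ : (LSite (F.P K).d → (Matrix (Fin 2) (Fin 2) ℂ)) →ₗ[ℂ] (LSite (F.P K).d → (Matrix (Fin 2) (Fin 2) ℂ))) (q : (LSite (F.P K).d → (Matrix (Fin 2) (Fin 2) ℂ)) →ₗ[ℂ] (ℕ → LSite (F.P K).d → (Matrix (Fin 2) (Fin 2) ℂ)))
        (qs : (ℕ → LSite (F.P K).d → (Matrix (Fin 2) (Fin 2) ℂ)) →ₗ[ℂ] (LSite (F.P K).d → (Matrix (Fin 2) (Fin 2) ℂ))) (Aw c : (ℕ → LSite (F.P K).d → (Matrix (Fin 2) (Fin 2) ℂ)) →ₗ[ℂ] (ℕ → LSite (F.P K).d → (Matrix (Fin 2) (Fin 2) ℂ)))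
        (H' : XSpace (F.P K).d (K - n) (Matrix (Fin 2) (Fin 2) ℂ) →ₗ[ℂ] (LSite (F.P K).d → (Matrix (Fin 2) (Fin 2) ℂ))),
      (∀ x, ∀ y ∈ (cubeFam false (F.P K).L a M' ρ' (K - n)) 0, (Δ (g x) + qs (Aw (q (g x)))) y = x y) ∧ (∀ f, q (g (g (qs (c (q f))))) = q f) ∧
      (∀ (f : LSite (F.P K).d → (Matrix (Fin 2) (Fin 2) ℂ)), ∀ x ∈ (cubeFam false (F.P K).L a M' ρ' (K - n)) 0, Δ f x = covLap (((F.L : ℝ)⁻¹) ^ (K - n)) (1 : LSite (F.P K).d → Fin (F.P K).d → (Matrix (Fin 2) (Fin 2) ℂ)ˣ) (((cubeFam false (F.P K).L a M' ρ' (K - n)) 0).indicator f) x) ∧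
      (∀ (μ : ℕ → LSite (F.P K).d → (Matrix (Fin 2) (Fin 2) ℂ)), ∀ x ∈ (cubeFam false (F.P K).L a M' ρ' (K - n)) 0, qs μ x = QT (F.P K).L (K - n) (cubeLamS (F.P K).L a M' ρ' (K - n) (K - n)) (1 : LSite (F.P K).d → Fin (F.P K).d → (Matrix (Fin 2) (Fin 2) ℂ)ˣ) μ x) ∧
      (∀ (f : LSite (F.P K).d → (Matrix (Fin 2) (Fin 2) ℂ)) (j : ℕ), j ≤ K - n → ∀ y ∈ (cubeLamS (F.P K).L a M' ρ' (K - n) (K - n)) j, q f j y = QprimeIter (zdBlocking (F.P K).d (F.P K).L) (bgT (F.P K).L (1 : LSite (F.P K).d → Fin (F.P K).d → (Matrix (Fin 2) (Fin 2) ℂ)ˣ)) j f y) ∧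
      (∀ (X : XSpace (F.P K).d (K - n) (Matrix (Fin 2) (Fin 2) ℂ)) (x : LSite (F.P K).d), ‖H' X x‖ ≤ B₀'H * ‖X‖) ∧
      (∀ j, j ≤ K - n → ∀ (X : XSpace (F.P K).d (K - n) (Matrix (Fin 2) (Fin 2) ℂ)), ∀ p ∈ {b : LSite (F.P K).d × Fin (F.P K).d | SideTouches ((cubeFam false (F.P K).L a M' ρ' (K - n)) j) b.1 b.2},
        wt (F.P K).L (((F.L : ℝ)⁻¹) ^ (K - n)) j * ‖covDerivFwd (((F.L : ℝ)⁻¹) ^ (K - n)) (1 : LSite (F.P K).d → Fin (F.P K).d → (Matrix (Fin 2) (Fin 2) ℂ)ˣ) p.2 (H' X) p.1‖ ≤ B₀'H * ‖X‖) ∧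
      (∀ X : XSpace (F.P K).d (K - n) (Matrix (Fin 2) (Fin 2) ℂ), Bd2 (F.P K).L (((F.L : ℝ)⁻¹) ^ (K - n)) (K - n) (cubeFam false (F.P K).L a M' ρ' (K - n)) (covLap (((F.L : ℝ)⁻¹) ^ (K - n)) (1 : LSite (F.P K).d → Fin (F.P K).d → (Matrix (Fin 2) (Fin 2) ℂ)ˣ) (H' X)) (B₂' * ‖X‖)) ∧
      (∀ (X : XSpace (F.P K).d (K - n) (Matrix (Fin 2) (Fin 2) ℂ)) (x : LSite (F.P K).d), x ∉ (cubeFam false (F.P K).L a M' ρ' (K - n)) 0 → H' X x = 0) ∧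
      (∀ X Y : XSpace (F.P K).d (K - n) (Matrix (Fin 2) (Fin 2) ℂ), (∀ p, Y p = -star (X p)) → ∀ x, H' Y x = -star (H' X x)) ∧
      (∀ (Y : XSpace (F.P K).d (K - n) (Matrix (Fin 2) (Fin 2) ℂ)) (j : ℕ) (hj : j ≤ K - n) (y : LSite (F.P K).d), y ∈ (cubeLamS (F.P K).L a M' ρ' (K - n) (K - n)) j →
        QprimeIter (zdBlocking (F.P K).d (F.P K).L) (bgT (F.P K).L (1 : LSite (F.P K).d → Fin (F.P K).d → (Matrix (Fin 2) (Fin 2) ℂ)ˣ)) j (H' Y) y = Y (⟨j, Nat.lt_succ_of_le hj⟩, y)) ∧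
      (∀ (f : LSite (F.P K).d → (Matrix (Fin 2) (Fin 2) ℂ)) (r : ℝ), 0 ≤ r → Bd2 (F.P K).L (((F.L : ℝ)⁻¹) ^ (K - n)) (K - n) (cubeFam false (F.P K).L a M' ρ' (K - n)) f r →
        (∀ x, ‖g f x‖ ≤ BG * r) ∧ ∀ j, j ≤ K - n → ∀ p ∈ {b : LSite (F.P K).d × Fin (F.P K).d | SideTouches ((cubeFam false (F.P K).L a M' ρ' (K - n)) j) b.1 b.2},
          wt (F.P K).L (((F.L : ℝ)⁻¹) ^ (K - n)) j * ‖covDerivFwd (((F.L : ℝ)⁻¹) ^ (K - n)) (1 : LSite (F.P K).d → Fin (F.P K).d → (Matrix (Fin 2) (Fin 2) ℂ)ˣ) p.2 (g f) p.1‖ ≤ BG * r) ∧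
      (∀ (f : LSite (F.P K).d → (Matrix (Fin 2) (Fin 2) ℂ)) (x : LSite (F.P K).d), x ∉ (cubeFam false (F.P K).L a M' ρ' (K - n)) 0 → g f x = 0) ∧
      (∀ f : LSite (F.P K).d → (Matrix (Fin 2) (Fin 2) ℂ), (∀ j, j ≤ K - n → ∀ x ∈ (cubeFam false (F.P K).L a M' ρ' (K - n)) j, IsSelfAdjoint (f x)) → ∀ x, IsSelfAdjoint (g f x)) ∧
      (∀ (f : LSite (F.P K).d → (Matrix (Fin 2) (Fin 2) ℂ)) (r : ℝ), 0 ≤ r → Bd2 (F.P K).L (((F.L : ℝ)⁻¹) ^ (K - n)) (K - n) (cubeFam false (F.P K).L a M' ρ' (K - n)) f r → Bd2 (F.P K).L (((F.L : ℝ)⁻¹) ^ (K - n)) (K - n) (cubeFam false (F.P K).L a M' ρ' (K - n)) (f - g (qs (c (q (g f))))) (BR * r)) ∧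
      (∀ f : LSite (F.P K).d → (Matrix (Fin 2) (Fin 2) ℂ), (∀ j, j ≤ K - n → ∀ x ∈ (cubeFam false (F.P K).L a M' ρ' (K - n)) j, IsSelfAdjoint (f x)) → ∀ j, j ≤ K - n → ∀ x ∈ (cubeFam false (F.P K).L a M' ρ' (K - n)) j, IsSelfAdjoint ((f - g (qs (c (q (g f))))) x)) ∧
      (∀ X : XSpace (F.P K).d (K - n) (Matrix (Fin 2) (Fin 2) ℂ), (∀ p, trCLM (Fin 2) (X p) = 0) → ∀ x, trCLM (Fin 2) (H' X x) = 0) ∧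
      (∀ f : LSite (F.P K).d → (Matrix (Fin 2) (Fin 2) ℂ), (∀ j, j ≤ K - n → ∀ x ∈ (cubeFam false (F.P K).L a M' ρ' (K - n)) j, trCLM (Fin 2) (f x) = 0) → ∀ x, trCLM (Fin 2) (g f x) = 0) ∧
      (∀ f : LSite (F.P K).d → (Matrix (Fin 2) (Fin 2) ℂ), (∀ j, j ≤ K - n → ∀ x ∈ (cubeFam false (F.P K).L a M' ρ' (K - n)) j, trCLM (Fin 2) (f x) = 0) → ∀ j, j ≤ K - n → ∀ x ∈ (cubeFam false (F.P K).L a M' ρ' (K - n)) j, trCLM (Fin 2) ((f - g (qs (c (q (g f))))) x) = 0))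
    -- SOCKET `H59γ`: T4γ's (1.59) clause at the knit gauge — ∀ `gJ` (J3's three guards) ∕ ∀ `g′`; SUPPORT antecedent for `u`; PRINT's split class ∪ level-0 crossing bonds; `+ B_∂·Φ₀`
    (H59γ : ∀ (gJ : GaugeTransf (F.P K) 0 (Matrix.specialUnitaryGroup (Fin 2) ℂ)),
      InAk (F.P K).L (K - n) (((F.L : ℝ)⁻¹) ^ (K - n)) ε₀ (fun _ => (Set.univ : Set (LSite (F.P K).d))) (pull (unitsField (toUField (GaugeField.gaugeAct gJ U))) 0) →
      (∀ m', m' ≤ K - n → ∀ Λ : ℕ → Set (LSite (F.P K).d), InAx (F.P K).L m' Λ (1 : LSite (F.P K).d → Fin (F.P K).d → (Matrix (Fin 2) (Fin 2) ℂ)ˣ) (pull (unitsField (toUField (GaugeField.gaugeAct gJ U))) 0)) →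
      (∀ m', m' ≤ K - n → ∀ (x : LSite (F.P K).d) (ν : Fin (F.P K).d), tlo (F.P K).L (tLo a ρ') m' ≤ x → x + e ν ≤ thi (F.P K).L (tHi a M' ρ') m' →
        ‖((avgIter (F.P K).L (pull (unitsField (toUField (GaugeField.gaugeAct gJ U))) 0) (K - n - m') x ν : (Matrix (Fin 2) (Fin 2) ℂ)ˣ) : Matrix (Fin 2) (Fin 2) ℂ) - 1‖ < s) →
      ∀ (g' : GaugeTransf (F.P K) 0 (Matrix (Fin 2) (Fin 2) ℂ)ˣ) (u : LSite (F.P K).d → (Matrix (Fin 2) (Fin 2) ℂ)ˣ) (V' : LSite (F.P K).d → Fin (F.P K).d → (Matrix (Fin 2) (Fin 2) ℂ)ˣ)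
        (A' : LSite (F.P K).d → Fin (F.P K).d → (Matrix (Fin 2) (Fin 2) ℂ)),
      (∀ x, u x ∈ unitaryUnits (Matrix (Fin 2) (Fin 2) ℂ)) → (∀ x, x ∉ (cubeFam false (F.P K).L a M' ρ' (K - n)) 0 → u x = 1) →
      mgauge (1 : LSite (F.P K).d → Fin (F.P K).d → (Matrix (Fin 2) (Fin 2) ℂ)ˣ) u V' = (pull (unitsField (toUField (GaugeField.gaugeAct gJ U))) 0) →
      Restr129 (F.P K).L (K - n) (Function.update (cubeLamS (F.P K).L a M' ρ' (K - n) (K - n)) (K - n) ∅) (1 : LSite (F.P K).d → Fin (F.P K).d → (Matrix (Fin 2) (Fin 2) ℂ)ˣ) u →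
      (IsLandau138W (F.P K).L (K - n) (((F.L : ℝ)⁻¹) ^ (K - n)) ((cubeFam false (F.P K).L a M' ρ' (K - n)) 0) (cubeLamS (F.P K).L a M' ρ' (K - n) (K - n)) (1 : LSite (F.P K).d → Fin (F.P K).d → (Matrix (Fin 2) (Fin 2) ℂ)ˣ) V' ∧
        (∀ c ∈ (cubeLamB (F.P K).L a M' ρ' (K - n) (K - n)) (K - n), ∀ (y : LSite (F.P K).d) (τ : Fin (F.P K).d),
          InBox (loK (F.P K).L (K - n) c.1) (bondHiK (F.P K).L (K - n) c.1 c.2) y → InBox (loK (F.P K).L (K - n) c.1) (bondHiK (F.P K).L (K - n) c.1 c.2) (y + e τ) →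
          V' y τ = gaugeActT g' (unitsField (toUField U)) ⟨cover (F.P K) y, τ⟩)) → (∀ y τ, IsSelfAdjoint (A' y τ)) →
      (∀ j, j ≤ K - n → ∀ y τ, SideTouches ((cubeFam false (F.P K).L a M' ρ' (K - n)) j) y τ →
        V' y τ = cfgExp (((F.L : ℝ)⁻¹) ^ (K - n)) A' y τ ∧ ‖A' y τ‖ ≤ (2 * ((F.P K).L * cstar) + 8 * α₄) * (((F.P K).L : ℝ) ^ j * (((F.L : ℝ)⁻¹) ^ (K - n)))⁻¹) →
      (∀ y τ, (∀ j, j ≤ K - n → ¬ SideTouches ((cubeFam false (F.P K).L a M' ρ' (K - n)) j) y τ) → A' y τ = 0) →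
      msup (F.P K).L (K - n) (((F.L : ℝ)⁻¹) ^ (K - n)) (-(1 : ℝ)) (fun j (b : LSite (F.P K).d × Fin (F.P K).d) => SideTouches ((cubeFam false (F.P K).L a M' ρ' (K - n)) j) b.1 b.2) (fun b => A' b.1 b.2)
          ≤ B₀ * (bondNorm (F.P K).L (K - n) (((F.L : ℝ)⁻¹) ^ (K - n)) (-(3 : ℝ)) (cubeFam false (F.P K).L a M' ρ' (K - n)) (fun x μ => Jcur (((F.L : ℝ)⁻¹) ^ (K - n)) (1 : LSite (F.P K).d → Fin (F.P K).d → (Matrix (Fin 2) (Fin 2) ℂ)ˣ) A' μ x)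
            + wsup 1 (fun p : {p : ℕ × (LSite (F.P K).d × Fin (F.P K).d) // p.1 ≤ K - n ∧ (p.2 ∈ (cubeLamBP' (F.P K).L a M' ρ' (K - n) (K - n)) p.1 ∨ (p.1 = 0 ∧ CrossB ((cubeFam false (F.P K).L a M' ρ' (K - n)) 0) p.2))} => linCovIter (F.P K).L (1 : LSite (F.P K).d → Fin (F.P K).d → (Matrix (Fin 2) (Fin 2) ℂ)ˣ) (iEta (((F.L : ℝ)⁻¹) ^ (K - n)) A') p.1.1 p.1.2.1 p.1.2.2))
            + Bbd * msup (F.P K).L (K - n) (((F.L : ℝ)⁻¹) ^ (K - n)) (-(1 : ℝ)) (fun j (b : LSite (F.P K).d × Fin (F.P K).d) => j = 0 ∧ SideTouches ((cubeFam false (F.P K).L a M' ρ' (K - n)) 0) b.1 b.2 ∧ ¬ BondTouches ((cubeFam false (F.P K).L a M' ρ' (K - n)) 0) b.1 b.2) (fun b => A' b.1 b.2) ∧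
        msup (F.P K).L (K - n) (((F.L : ℝ)⁻¹) ^ (K - n)) (-(2 : ℝ)) (fun j (t : Fin (F.P K).d × Fin (F.P K).d × LSite (F.P K).d) => SideTouches ((cubeFam false (F.P K).L a M' ρ' (K - n)) j) t.2.2 t.2.1) (fun t => covDerivFwd (((F.L : ℝ)⁻¹) ^ (K - n)) (1 : LSite (F.P K).d → Fin (F.P K).d → (Matrix (Fin 2) (Fin 2) ℂ)ˣ) t.1 (fun z => A' z t.2.1) t.2.2)
          ≤ B₀ * (bondNorm (F.P K).L (K - n) (((F.L : ℝ)⁻¹) ^ (K - n)) (-(3 : ℝ)) (cubeFam false (F.P K).L a M' ρ' (K - n)) (fun x μ => Jcur (((F.L : ℝ)⁻¹) ^ (K - n)) (1 : LSite (F.P K).d → Fin (F.P K).d → (Matrix (Fin 2) (Fin 2) ℂ)ˣ) A' μ x)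
            + wsup 1 (fun p : {p : ℕ × (LSite (F.P K).d × Fin (F.P K).d) // p.1 ≤ K - n ∧ (p.2 ∈ (cubeLamBP' (F.P K).L a M' ρ' (K - n) (K - n)) p.1 ∨ (p.1 = 0 ∧ CrossB ((cubeFam false (F.P K).L a M' ρ' (K - n)) 0) p.2))} => linCovIter (F.P K).L (1 : LSite (F.P K).d → Fin (F.P K).d → (Matrix (Fin 2) (Fin 2) ℂ)ˣ) (iEta (((F.L : ℝ)⁻¹) ^ (K - n)) A') p.1.1 p.1.2.1 p.1.2.2))
            + Bbd * msup (F.P K).L (K - n) (((F.L : ℝ)⁻¹) ^ (K - n)) (-(1 : ℝ)) (fun j (b : LSite (F.P K).d × Fin (F.P K).d) => j = 0 ∧ SideTouches ((cubeFam false (F.P K).L a M' ρ' (K - n)) 0) b.1 b.2 ∧ ¬ BondTouches ((cubeFam false (F.P K).L a M' ρ' (K - n)) 0) b.1 b.2) (fun b => A' b.1 b.2)) :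
              ∃ (t : ℤ) (_ : 0 ≤ t) (_ : t ≤ (M' : ℤ) - 1) (gJ : GaugeTransf (F.P K) 0 (Matrix.specialUnitaryGroup (Fin 2) ℂ))
                (u₁ : LSite (F.P K).d → (Matrix (Fin 2) (Fin 2) ℂ)ˣ) (W : LSite (F.P K).d → Fin (F.P K).d → (Matrix (Fin 2) (Fin 2) ℂ)ˣ)
                (A : LSite (F.P K).d → Fin (F.P K).d → Matrix (Fin 2) (Fin 2) ℂ) (c₁ c' : ℝ)
                (κf : (Site (F.P K) 0 → Matrix (Fin 2) (Fin 2) ℂ) → (i : ℕ) → GaugeTransf (F.P K) i (Matrix (Fin 2) (Fin 2) ℂ)ˣ)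
                (lam : LSite (F.P K).d → Matrix (Fin 2) (Fin 2) ℂ) (α₄ cA : ℝ),
                (∀ z, ((u₁ z : (Matrix (Fin 2) (Fin 2) ℂ)ˣ) : Matrix (Fin 2) (Fin 2) ℂ) ∈ Matrix.specialUnitaryGroup (Fin 2) ℂ) ∧
                (mgauge (1 : LSite (F.P K).d → Fin (F.P K).d → (Matrix (Fin 2) (Fin 2) ℂ)ˣ) u₁ W = pull (unitsField (toUField (GaugeField.gaugeAct gJ U))) 0) ∧
                (∀ b ∈ {b : LSite (F.P K).d × Fin (F.P K).d | SideTouches (cubeFam false (F.P K).L (fun μ => ((iterBlockOf (K - n) x₀ μ).val : ℤ) - t) M' (ρ + M + L + S) (K - n) 0) b.1 b.2},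
      W b.1 b.2 = cfgExp (((F.L : ℝ)⁻¹) ^ (K - n)) A b.1 b.2) ∧ (0 ≤ c') ∧ (8 * 3800 * ((((F.P K).d + 2) * (F.P K).L : ℕ) : ℝ) ^ 2 * c' ≤ 1) ∧
                (Real.exp c₁ - 1 ≤ ((F.L : ℝ)⁻¹) ^ (K - n) * c') ∧
                (∀ z ∈ cube (F.P K).L (fun μ => ((iterBlockOf (K - n) x₀ μ).val : ℤ) - t) M' (ρ + M + L + S) (K - n) (K - n), ∀ ν : Fin (F.P K).d,
      W z ν = cfgExp (((F.L : ℝ)⁻¹) ^ (K - n)) A z ν ∧ ((F.L : ℝ)⁻¹) ^ (K - n) * ‖A z ν‖ ≤ c₁) ∧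
                (∀ (m : Site (F.P K) 0 → Matrix (Fin 2) (Fin 2) ℂ) (i : ℕ) (y : Site (F.P K) (i + 1)), κf m (i + 1) y = (vframeU (gaugeActT (κf m i) (dbarIterU i (gaugeActT
        (fun s => (u₁ (lift (F.P K) x₀ + rel x₀ s))⁻¹ * Unitary.toUnits (suIncl (gJ s)) : GaugeTransf (F.P K) 0 (Matrix (Fin 2) (Fin 2) ℂ)ˣ)
        (unitsField (toUField U))))) y)⁻¹ * κf m i (emb y) * vframeU (dbarIterU i (gaugeActT
          (fun s => (u₁ (lift (F.P K) x₀ + rel x₀ s))⁻¹ * Unitary.toUnits (suIncl (gJ s)) : GaugeTransf (F.P K) 0 (Matrix (Fin 2) (Fin 2) ℂ)ˣ) (unitsField (toUField U)))) y) ∧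
                (∀ (m : Site (F.P K) 0 → Matrix (Fin 2) (Fin 2) ℂ) (x : Site (F.P K) 0), ((κf m 0 x : (Matrix (Fin 2) (Fin 2) ℂ)ˣ) : Matrix (Fin 2) (Fin 2) ℂ) = exp (m x)) ∧
                (0 ≤ α₄) ∧ (α₄ ≤ 1 / 70) ∧ (0 ≤ cA) ∧ (cA ≤ 1 / 12) ∧ (∀ x, IsSelfAdjoint (lam x)) ∧ (∀ x, (lam x).trace = 0) ∧
                (∀ x, x ∉ cubeFam false (F.P K).L (fun μ => ((iterBlockOf (K - n) x₀ μ).val : ℤ) - t) M' (ρ + M + L + S) (K - n) 0 → lam x = 0) ∧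
                (∀ b ∈ {b : LSite (F.P K).d × Fin (F.P K).d | SideTouches (cubeFam false (F.P K).L (fun μ => ((iterBlockOf (K - n) x₀ μ).val : ℤ) - t) M' (ρ + M + L + S) (K - n) 0) b.1 b.2},
      ‖lam b.1‖ ≤ α₄ ∧ wt (F.P K).L (((F.L : ℝ)⁻¹) ^ (K - n)) 0 *
        ‖covDerivFwd (((F.L : ℝ)⁻¹) ^ (K - n)) (1 : LSite (F.P K).d → Fin (F.P K).d → (Matrix (Fin 2) (Fin 2) ℂ)ˣ) b.2 lam b.1‖ ≤ α₄) ∧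
                (∃ μ : ℕ → LSite (F.P K).d → Matrix (Fin 2) (Fin 2) ℂ, ∀ x ∈ cubeFam false (F.P K).L (fun μ => ((iterBlockOf (K - n) x₀ μ).val : ℤ) - t) M' (ρ + M + L + S) (K - n) 0,
      covLap (((F.L : ℝ)⁻¹) ^ (K - n)) (1 : LSite (F.P K).d → Fin (F.P K).d → (Matrix (Fin 2) (Fin 2) ℂ)ˣ)
        ((cubeFam false (F.P K).L (fun μ => ((iterBlockOf (K - n) x₀ μ).val : ℤ) - t) M' (ρ + M + L + S) (K - n) 0).indicator fun y =>
          covDivB (((F.L : ℝ)⁻¹) ^ (K - n)) (1 : LSite (F.P K).d → Fin (F.P K).d → (Matrix (Fin 2) (Fin 2) ℂ)ˣ) A y +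
          covLap (((F.L : ℝ)⁻¹) ^ (K - n)) (1 : LSite (F.P K).d → Fin (F.P K).d → (Matrix (Fin 2) (Fin 2) ℂ)ˣ) lam y +
          ((conjR (gaugeExp lam y)⁻¹ (covDivB (((F.L : ℝ)⁻¹) ^ (K - n)) (1 : LSite (F.P K).d → Fin (F.P K).d → (Matrix (Fin 2) (Fin 2) ℂ)ˣ) A y) -
              covDivB (((F.L : ℝ)⁻¹) ^ (K - n)) (1 : LSite (F.P K).d → Fin (F.P K).d → (Matrix (Fin 2) (Fin 2) ℂ)ˣ) A y) +
            (gAd (covLap (((F.L : ℝ)⁻¹) ^ (K - n)) (1 : LSite (F.P K).d → Fin (F.P K).d → (Matrix (Fin 2) (Fin 2) ℂ)ˣ) lam y) (lam y) -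
              covLap (((F.L : ℝ)⁻¹) ^ (K - n)) (1 : LSite (F.P K).d → Fin (F.P K).d → (Matrix (Fin 2) (Fin 2) ℂ)ˣ) lam y) +
            ∑ μ, frakF3 (((F.L : ℝ)⁻¹) ^ (K - n)) (1 : LSite (F.P K).d → Fin (F.P K).d → (Matrix (Fin 2) (Fin 2) ℂ)ˣ) lam A y μ)) x =
        QT (F.P K).L (K - n) (cubeLamS (F.P K).L (fun μ => ((iterBlockOf (K - n) x₀ μ).val : ℤ) - t) M' (ρ + M + L + S) (K - n) (K - n)) (1 : LSite (F.P K).d → Fin (F.P K).d → (Matrix (Fin 2) (Fin 2) ℂ)ˣ) μ x) ∧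
                (∀ yc ∈ cubeLamS (F.P K).L (fun μ => ((iterBlockOf (K - n) x₀ μ).val : ℤ) - t) M' (ρ + M + L + S) (K - n) (K - n) (K - n),
      κf (((-I) • lam) ∘ fun s : Site (F.P K) 0 => lift (F.P K) x₀ + rel x₀ s) (K - n) (coverAt (F.P K) (K - n) yc) = axialT (dbarIterU (K - n) (gaugeActT
          (fun s => (u₁ (lift (F.P K) x₀ + rel x₀ s))⁻¹ * Unitary.toUnits (suIncl (gJ s)) : GaugeTransf (F.P K) 0 (Matrix (Fin 2) (Fin 2) ℂ)ˣ)
          (unitsField (toUField U)))) (iterBlockOf (K - n) x₀) (coverAt (F.P K) (K - n) yc)) ∧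
                (∀ x ∈ cubeFam false (F.P K).L (fun μ => ((iterBlockOf (K - n) x₀ μ).val : ℤ) - t) M' (ρ + M + L + S) (K - n) 0, ∀ μ : Fin (F.P K).d,
      wt (F.P K).L (((F.L : ℝ)⁻¹) ^ (K - n)) 0 * ‖A x μ‖ ≤ cA ∧ wt (F.P K).L (((F.L : ℝ)⁻¹) ^ (K - n)) 0 *
          ‖conjR ((1 : LSite (F.P K).d → Fin (F.P K).d → (Matrix (Fin 2) (Fin 2) ℂ)ˣ) (x - e μ) μ)⁻¹ (A (x - e μ) μ)‖ ≤ cA) ∧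
                (∀ j, j ≤ K - n → ∀ z ∈ cube (F.P K).L (fun μ => ((iterBlockOf (K - n) x₀ μ).val : ℤ) - t) M' (ρ + M + L + S) (K - n) j, ∀ ν' : Fin (F.P K).d,
      (F.L : ℝ) ^ j * ((F.L : ℝ)⁻¹) ^ (K - n) * ‖logCfg (((F.L : ℝ)⁻¹) ^ (K - n)) (mgauge (1 : LSite (F.P K).d → Fin (F.P K).d → (Matrix (Fin 2) (Fin 2) ℂ)ˣ) (gaugeExp lam)⁻¹
          (cfgExp (((F.L : ℝ)⁻¹) ^ (K - n)) A)) z ν'‖ ≤ Bsz * ε₀) ∧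
                (∀ j, j ≤ K - n → ∀ z ∈ cube (F.P K).L (fun μ => ((iterBlockOf (K - n) x₀ μ).val : ℤ) - t) M' (ρ + M + L + S) (K - n) j, ∀ ν' μ' : Fin (F.P K).d,
      z + e μ' ∈ cube (F.P K).L (fun μ => ((iterBlockOf (K - n) x₀ μ).val : ℤ) - t) M' (ρ + M + L + S) (K - n) 0 →
      ((F.L : ℝ) ^ j * ((F.L : ℝ)⁻¹) ^ (K - n)) ^ 2 * (F.L : ℝ) ^ (K - n) *
        ‖logCfg (((F.L : ℝ)⁻¹) ^ (K - n)) (mgauge (1 : LSite (F.P K).d → Fin (F.P K).d → (Matrix (Fin 2) (Fin 2) ℂ)ˣ) (gaugeExp lam)⁻¹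
            (cfgExp (((F.L : ℝ)⁻¹) ^ (K - n)) A)) (z + e μ') ν' -
          logCfg (((F.L : ℝ)⁻¹) ^ (K - n)) (mgauge (1 : LSite (F.P K).d → Fin (F.P K).d → (Matrix (Fin 2) (Fin 2) ℂ)ˣ) (gaugeExp lam)⁻¹
            (cfgExp (((F.L : ℝ)⁻¹) ^ (K - n)) A)) z ν'‖ ≤ Bsz * ε₀) := by
  classical
  letI : CStarAlgebra (Matrix (Fin 2) (Fin 2) ℂ) := B10Eq29TubeLine.cstarAlgebraMatrix 2
  have hcs16 : cstar ≤ 1 / 16 := by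
    have h2 : 2 * cstar ≤ (F.P K).L * cstar := mul_le_mul_of_nonneg_right (by exact_mod_cast (F.P K).hL.2) (by rw [hc]; positivity)
    linarith only [h2, hs₂]
  obtain ⟨gJ, u₁, W, A, κf, hInAk, hInAx, htw, hu₁SU, hu₁S, h129, hW, hLan, hdat, hAτ, hκfs, hκf0⟩ :=
    siteDatum_of_T4Tγ F L hF hnK h2 ρ S M M' hρ'def hε₀ hε hsdef hs6 hroom V U hU x₀ ht0 ht hadef hcs16 hT4Tγ
  -- `H59Dγ` read at the datum (✓(γ-3b) `datumRowsγ`): Theorem 4's clause FOR THIS DATUM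
  have hu₁ : ∀ x, u₁ x ∈ unitaryUnits (Matrix (Fin 2) (Fin 2) ℂ) :=
    fun x => specialUnitaryUnits_le_unitaryUnits (mem_specialUnitaryUnits.2 (hu₁SU x))
  have hU' : ∀ (x : LSite (F.P K).d) (κ : Fin (F.P K).d), pull (unitsField (toUField (GaugeField.gaugeAct gJ U))) 0 x κ ∈ unitaryUnits (Matrix (Fin 2) (Fin 2) ℂ) :=
    fun x κ => by rw [pull_apply]; exact unitsField_mem_unitaryUnits _ _
  obtain ⟨hWu, hIW⟩ := datumRowsγ (Nat.sub_le (K - n) 1) hU' hu₁ hW hInAk (cubeFam false (F.P K).L a M' ρ' (K - n))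
  have H59Dβm := fun A' hsa hUA hA0 => H59Dγ W A' hWu hIW hLan hsa hUA hA0
  -- THE TOP STEP, edition γ (✓(γ-2c))
  obtain ⟨lam, hsa, hsupp, hτ0, h108, hmult, hlo, htopId, hA0⟩ :=
    siteTop_of_datum_γ F L hF hnK h2 ρ S M M' hρ'def hε₀ hroom U x₀ ht0 ht hadef hα₁ hB₀ hB₀' hsα₁ hc hα₄ hs₂ hside₀ hC₂ h61₀ hsmall₁
      hα3γ hα4γ h16γ hsmallγ hc₃γ
      hcBlo hcAlo hcDAlo hα3 hα4 hsmall hc₃ hsc hα₃' hs₁ hs₂' hs₃ hs₄ hs₅ hs₆ hs₇ hprod8 hcA13 hCblo hCllo hCbρ hClB hB₀'H hB₂' hBG hBR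
      hσ hδ hω hτ₀ hbudget hm hm₀ hr hCb₀ hCl₀ hwin SLetτ gJ u₁ W A κf hInAk hInAx htw hu₁SU hu₁S h129 hW hLan hdat hAτ hBbd hBd H59Dβm hκfs hκf0
  subst hadef hρ'def
  -- letters of the member
  have hd2 : 2 ≤ (F.P K).d := (by rw [T3Family.P_d F K]; norm_num); have hL2 : 2 ≤ (F.P K).L := (F.P K).hL.2
  have hL1 : 1 ≤ (F.P K).L := le_trans (by norm_num) hL2; have hLF : (F.P K).L = F.L := rfl
  have hLr1 : (1 : ℝ) ≤ (F.P K).L := (by exact_mod_cast hL1); have hρL : (F.P K).L ≤ ρ + M + L + S := by rw [hLF, hF]; omega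
  have hcs0 : 0 ≤ cstar := (by rw [hc]; positivity); have hα₄pos : 0 < α₄ := by rw [hα₄]; positivity
  have ha := corner_of_offset x₀ (K - n) (M' := M') ht0 ht
  obtain ⟨hroomW, -, -⟩ := HalvingHSiteDatumOfSockets.member_windows F L hF hnK ρ S M M' (ε₀ := ε₀) hroom x₀ ht0 ht
  -- the level letter `m := K − n − 1 ≥ 1`
  obtain ⟨m, hkm⟩ : ∃ m, K - n = m + 1 := ⟨K - n - 1, by omega⟩
  have hmK : K - n - 1 = m := (by omega); have hηm : 0 < ((F.L : ℝ)⁻¹) ^ (m + 1) := by positivity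
  rw [hmK] at hdat hAτ h129 hLan
  -- the trace of `λ′`, the chart on the touched sides of `□₀`, the chart-with-size on `□_k`, `c₁`, `c′`
  have htr : ∀ x, (lam x).trace = 0 := fun x => by rw [← trCLM_apply]; exact hτ0 x
  have hchart₀ : ∀ b ∈ {b : LSite (F.P K).d × Fin (F.P K).d |
        SideTouches (cubeFam false (F.P K).L (fun μ => ((iterBlockOf (K - n) x₀ μ).val : ℤ) - t) M' (ρ + M + L + S) (K - n) 0) b.1 b.2},
      W b.1 b.2 = cfgExp (((F.L : ℝ)⁻¹) ^ (K - n)) A b.1 b.2 :=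
    fun b hb => (hdat 0 (Nat.zero_le _) b hb).1
  have hdat' := hdat; rw [hkm] at hdat'
  have hchartTopm := hchartTop_of_hdat (𝔸 := Matrix (Fin 2) (Fin 2) ℂ) hd2 _ M' (ρ + M + L + S) m hηm hdat'
  have hchartTop : ∀ z ∈ cube (F.P K).L (fun μ => ((iterBlockOf (K - n) x₀ μ).val : ℤ) - t) M' (ρ + M + L + S) (K - n) (K - n), ∀ ν : Fin (F.P K).d,
      W z ν = cfgExp (((F.L : ℝ)⁻¹) ^ (K - n)) A z ν ∧ (((F.L : ℝ)⁻¹) ^ (K - n)) * ‖A z ν‖ ≤ cstar * (((F.P K).L : ℝ) ^ m)⁻¹ := by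
    rw [hkm]; exact hchartTopm
  have hcsm1 : cstar * (((F.P K).L : ℝ) ^ m)⁻¹ ≤ 1 := by
    have h1 : (((F.P K).L : ℝ) ^ m)⁻¹ ≤ 1 := inv_le_one_of_one_le₀ (one_le_pow₀ hLr1)
    have h3 : cstar ≤ (F.P K).L * cstar := le_mul_of_one_le_left hcs0 hLr1
    calc cstar * (((F.P K).L : ℝ) ^ m)⁻¹ ≤ 1 * 1 := mul_le_mul (by linarith only [h3, hs₂]) h1 (by positivity) (by norm_num)
      _ = 1 := one_mul _
  have hc₁ : Real.exp (cstar * (((F.P K).L : ℝ) ^ m)⁻¹) - 1 ≤ (((F.L : ℝ)⁻¹) ^ (K - n)) * (2 * (F.P K).L * cstar) := by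
    have h := hc₁_of_small hL1 m hcs0 hcsm1
    rw [hkm]; exact h
  have hbudget' : 8 * 3800 * ((((F.P K).d + 2) * (F.P K).L : ℕ) : ℝ) ^ 2 * (2 * (F.P K).L * cstar) ≤ 1 :=
    le_trans (mul_le_mul_of_nonneg_left hσ (by positivity)) hbudget
  -- the knit clause at the datum (✓p655738); the sockets at the top-knit gauge `g′ := ((u₁·e^{iλ′}) ∘ rep)⁻¹·ĝJ`
  have hknit := hknit_of_descent x₀ ha hroomW U gJ hu₁ hW hsa
  -- (1.42) at the knit gauge: inner top class by the `HTOP` instance (ε₁-route), collar bonds by the displayed `H42topCrossL` (✓(γ-3c) `H42_of_rows_γ`)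
  have htop := HTOP gJ u₁ W A (cstar * (((F.P K).L : ℝ) ^ m)⁻¹) (2 * (F.P K).L * cstar) κf lam hu₁SU hW (by positivity) hbudget' hc₁ hchartTop hκfs hκf0 hsa htr htopId
  have hα₂ : 0 ≤ 2 * ((F.P K).L * cstar) + 8 * α₄ := by positivity
  have htwα := fun m' hm' x ν h1 h2 => lt_of_lt_of_le (htw m' hm' x ν h1 h2) hsα₁
  have hr42' := hr42; have hr2' := hr2; rw [hmK] at hr42' hr2'
  have H42' := H42_of_rows_γ F hd2 hnK x₀ hρL ha hroomW hε₀ U gJ hInAk hInAx htwα hu₁ hW hchartTop hsa h108 htop hα₁ hα₂ hα3γ hα4γ h16Pγ hsmallPγ hc₃Pγ hsmall₁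
    hkb hbudget42 hr42' hr2' hwin42 (H42topCrossL gJ hInAk hInAx htw (fun s => ((u₁ * gaugeExp lam) (lift (F.P K) x₀ + rel x₀ s))⁻¹ * Unitary.toUnits (suIncl (gJ s))))
  have H59' := H59γ gJ hInAk hInAx htw (fun s => ((u₁ * gaugeExp lam) (lift (F.P K) x₀ + rel x₀ s))⁻¹ * Unitary.toUnits (suIncl (gJ s)))
  -- T4γ's β rows at `aβ := s` (✓(γ-3b)): (1.66)₀ on the sides touching `□₀` off J3's tower row (d) at depth `K − n`, and the three scalar rows
  have h66 := h66_of_towerRow hL2 (le_trans hL1 hρL) htw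
  have hs0 : 0 ≤ s := by
    have hM1 : (1 : ℝ) ≤ M' := by exact_mod_cast (show 1 ≤ M' by omega)
    have hρ0 : (0 : ℝ) ≤ ((ρ + M + L + S : ℕ) : ℝ) := Nat.cast_nonneg _
    rw [hsdef]; exact mul_nonneg (by linarith) hε₀.le
  obtain ⟨hs4, hsdL, hbdry⟩ := betaScalarRows (by exact_mod_cast (show 1 ≤ (F.P K).d by omega) : (1 : ℝ) ≤ (F.P K).d) hLr1 hs0 hs6 hsα₁ hα₁ hε₀ hB₀ hBd
  have hηL : (((F.L : ℝ)⁻¹) ^ (m + 1))⁻¹ = ((F.P K).L : ℝ) ^ (m + 1) := by rw [hLF, inv_pow, inv_inv]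
  -- transport to the callee's level letter `m + 1` (✓p654113 is lettered at `m + 1`)
  have hInAk' := hInAk; have hInAx' := hInAx; have h129' := h129; have hsupp' := hsupp; have h108' := h108; have hmult' := hmult
  have hlo' := hlo; have hA0' := hA0; have hknit' := hknit; have hu₁S' := hu₁S; have h66' := h66
  rw [hkm] at hInAk' hInAx' H42' H59' h129' hsupp' h108' hmult' hlo' hA0' hknit' hu₁S' h66'
  -- THE SIZES at the member (✓p654113 at `m := K − n − 1`, `Bε := Bsz·ε₀`)
  obtain ⟨hX1, hX2⟩ := siteSizeRows_of_topRows_γ (𝔸 := Matrix (Fin 2) (Fin 2) ℂ) hd2 hηm hL2 (a := fun μ => ((iterBlockOf (m + 1) x₀ μ).val : ℤ) - t)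
    (M' := M') hρL (m := m) rfl rfl rfl hU' hε₀ hα₁ hα₄pos hB₀ hc hInAk' hInAx'
    hα3γ hα4γ h16 hd5 hsmallPγ hc₃Pγ hside h50 hC₂ h61 hBbd hs0 hs4 hbdry hsdL h66' hcBlo hsmall hc₃ hsc hα₃' hs₁ hs₂' hs₃ hs₄ hs₅ hs₆ hprod8 _
    H42' H59' hu₁ hu₁S' hW h129' hdat' hα70 hcA0 hcA12 hsa hsupp' h108' hmult' hlo' hA0' hknit' hcsB hηL
  refine ⟨t, ht0, ht, gJ, u₁, W, A, cstar * (((F.P K).L : ℝ) ^ m)⁻¹, 2 * (F.P K).L * cstar, κf, lam, α₄, cA,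
    hu₁SU, hW, hchart₀, by positivity, hbudget', hc₁, hchartTop, hκfs, hκf0, hα₄pos.le, hα70, hcA0, hcA12, hsa, htr, hsupp,
    h108 0 (Nat.zero_le _), hmult, htopId, hA0, ?_, ?_⟩
  · rw [hkm]; exact hX1
  · rw [hkm]; exact hX2

end Summit.QuantumFields.YangMills.Theorems.HalvingHSiteRowsOfSocketsTGamma

end
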